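import Literature.Computability.FineGrained.OVFromSETH
import HarnessLib

/-!
# SETH ⇒ `k`-OV (fine-grained.S09, `k`-list form): decomposition of the printed theorem

Companion to `Literature.Computability.FineGrained.SETHHardness` for the named fact
`not_kOVWithDim_inTimeO_of_sethWordRAM` (**fine-grained.S09**, `k`-list form): assuming word-RAM
SETH, for every `k ≥ 2` and `ε > 0` there is `c ≥ 1` such that `k`-Orthogonal Vectors on `n`
vectors per list in dimension `d = c ⌊log₂ n⌋` (`kOVWithDim k c`) has no deterministic
`O(n^{k-ε})`-time word-RAM algorithm.

## Source

The `k`-list statement is V. Vassilevska Williams, *On some fine-grained questions in algorithms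
and complexity*, Proc. ICM 2018, §3, **Thm. 3.1** (p. 7–8 of the author's version, attributed there
to R. Williams, TCS 348 (2005)): "If `k`-OV on sets with `N` vectors from `{0,1}^m` can be solved in
`N^{k-ε} poly(m)` time for any `ε > 0`, then CNF-SAT on `n` variables and `m` clauses can be solved
in `2^{(1-ε')n} poly(m)` time for some `ε' > 0` and SETH is false", with the printed proof: split the
variables into `k` parts of `n/k` variables, list the `N = 2^{n/k}` assignments of each part, give
assignment `φ` of part `j` the vector `a_j(φ) ∈ {0,1}^m` with `a_j(φ)[c] = 0` iff `φ` satisfies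
clause `c`; an orthogonal `k`-tuple is exactly a satisfying assignment, and `N^{k-ε} poly(m) =
2^{(1-ε/k) n} poly(m)`; followed by the remark (p. 8) that by the sparsification lemma of
Impagliazzo–Paturi–Zane one may assume `m = O(n)`, so that dimension `d = c log N` suffices — which
is the regime `kOVWithDim k c` of the named fact. Williams' own paper (TCS 348 (2005), §5.1, Thm. 5
of the author's version = Thm. 5.1) prints the case `k = 2` (cooperative subset queries). SETH there
is the word-RAM hypothesis (ICM 2018, §3, Hypothesis 1; §2: "All hypotheses are about the word-RAM
model of computation with `O(log n)` bit words"), i.e. `SETHWordRAM` of the statement file in its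
deterministic reading.

## Decomposition

Exactly as for the two-list case (`OVFromSETH.lean`, whose architecture and conventions this file
follows), the printed proof has two machine-level ingredients and an assembly:

* `kSATInRAMTime_of_sparseKSATInRAMTime_serf` (named fact of `OVFromSETH.lean`, shared with the
  two-list case): sparsification as a SERF reduction on the word RAM at SETH granularity
  (Impagliazzo–Paturi–Zane, JCSS 63 (2001), Thm. 1, Cor. 1–2);
* `sparseKSATInRAMTime_of_kOV_inTimeO` (named fact, this file): the `k`-way split-and-list
  reduction on the word RAM in the regime `d = c log N` — if for some `0 < ε ≤ 1` and every `c ≥ 1`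
  `kOVWithDim k c` has a deterministic `O(n^{k-ε})`-time word-RAM algorithm, then for every width
  `k'`, every density `c'` and every `δ > 1 - ε/k` the sparse `k'`-CNFs of density `c'` are decided
  in word-RAM time `O(2^{δ n})` (`SparseKSATInRAMTime k' c' δ` of `CliqueETH.lean`);
* `not_kOVWithDim_inTimeO_of_sethWordRAM_of` — **assembly (proved here)**: the two facts imply the
  target verbatim (given `k ≥ 2` and `ε`, shrink `ε` below `1`; sparse `k'`-SAT of every density is
  then in time `O(2^{(1 - 3ε/(4k)) n})`, hence `k'`-SAT in time `O(2^{(1 - ε/(2k)) n})` for every `k'`,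
  contradicting word-RAM SETH at `ε/(2k)`).

What remains for `not_kOVWithDim_inTimeO_of_sethWordRAM_holds`: the two word-RAM programs (for the
second, the toolkit of `CliqueETHReductionProgram.lean` — structured code `SProg`, the logic
`SProg.Achieves`, one emulated sub-run `SProg.withSubrun` of the hypothetical `k`-OV program at its
own word size — applies verbatim; the instance to build is simpler than the position graph of the
clique reduction: `k` tables of `N · d` bits, bit `(l, a, j)` being "partial assignment `a` of group
`l` does not already satisfy clause `j`").

## References

* V. Vassilevska Williams, *On some fine-grained questions in algorithms and complexity*,
  Proc. ICM 2018, Vol. 4, 3447–3487: §2 (word RAM), §3 Hypothesis 1 (SETH), Hypothesis 4 (`k`-OV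
  Hypothesis), Thm. 3.1 and the remark following its proof (p. 7–8 of the author's version).
* R. Williams, *A new algorithm for optimal 2-constraint satisfaction and its implications*,
  Theoret. Comput. Sci. 348 (2005) 357–365, §5.1, Thm. 5.1 (Thm. 5 of the author's version; `k = 2`).
* R. Impagliazzo, R. Paturi, F. Zane, *Which problems have strongly exponential complexity?*,
  J. Comput. Syst. Sci. 63 (2001) 512–530, Thm. 1, Cor. 1, Cor. 2.
-/

namespace Literature.Computability.FineGrained

open Cryptography Cryptography.WordRAM

/-! ### The machine-level ingredient: the `k`-way split-and-list reduction on the word RAM -/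

/-- **Williams' split-and-list reduction with `k` lists on the word RAM, in the regime
`d = c log N` (named fact).** If for some `k ≥ 2`, some `0 < ε ≤ 1` and every `c ≥ 1`,
`k`-Orthogonal Vectors on `n` vectors per list in dimension `d = c ⌊log₂ n⌋` (`kOVWithDim k c`) has a
deterministic `O(n^{k-ε})`-time word-RAM algorithm, then for every width `k'`, every density `c'`
and every `δ > 1 - ε/k`, the `k'`-CNFs with at most `c' · n` clauses (instances of `kSATProblem k'`,
`n = numVars`) are decided on the deterministic word RAM in time `O(2^{δ n})`
(`SparseKSATInRAMTime k' c' δ`). Printed form (V. Vassilevska Williams, ICM 2018, §3, Thm. 3.1 and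
its proof, after R. Williams, TCS 348 (2005), §5.1): "If `k`-OV on sets with `N` vectors from
`{0,1}^m` can be solved in `N^{k-ε} poly(m)` time for any `ε > 0`, then CNF-SAT on `n` variables and
`m` clauses can be solved in `2^{(1-ε')n} poly(m)` time for some `ε' > 0`" with `ε' = ε/k`: split the
variables into `k` parts `V_1, …, V_k` of `n/k` variables, for every part `j` and each of the
`N = 2^{n/k}` assignments `φ` of `V_j` form the vector `a_j(φ) ∈ {0,1}^m` with `a_j(φ)[c] = 0` iff
`φ` satisfies clause `c`; then `a_1(φ_1), …, a_k(φ_k)` have coordinatewise product `0` iff the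
concatenation `φ_1 ⋯ φ_k` satisfies every clause, and one run of the `k`-OV algorithm costs
`(2^{n/k})^{k-ε} poly(m) = 2^{(1-ε/k) n} poly(m)`. The reduction used here, in the zoo's conventions:
parts of `g = ⌊n/k⌋ + 1` consecutive variables (so `N = 2^g ≥ 2` and all `n < k g` variables are
covered), dimension `d = c g = c ⌊log₂ N⌋` with `c = c' k + 1 ≥ 1` (so the `m ≤ c' n < d` clauses fit
and the padding coordinates `j ≥ m` are `0` in every vector), the `k` tables written as the
`kOV k` input `N :: d :: tables` for one emulated run of the hypothetical program for this `c` (at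
its own word size, by masking in relocated memory); total time
`O(k N d · k' ) + O(N^{k-ε}) = O(n 2^{n/k}) + O(2^{(1-ε/k)(n + k)}) = O(2^{δ n})` for every
`δ > 1 - ε/k` (note `1 - ε/k ≥ 1/k` as `ε ≤ 1 ≤ k - 1`). The hypothesis is used only for the one
constant `c = c' k + 1`; `ε ≤ 1` because an `o(N d)` bound could not even read the instance (the
assembly shrinks any `ε` below `1`). **Scope.** Print covers CNF-SAT with `m ≤ c' n` clauses of any
width; the statement here is its specialisation to the instances of `kSATProblem k'` (every `k'`),
which is what the assembly `not_kOVWithDim_inTimeO_of_sethWordRAM_of` consumes. For `k = 2` this is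
the two-list fact `sparseKSATInRAMTime_of_ov_subquadratic` of `OVFromSETH.lean` up to the
identification of `kOVWithDim 2 c` with `OVWithDim c`.
[cite: VassilevskaWilliamsICM2018, §3 Thm. 3.1 (proof)]
[cite: WilliamsTCS2005, §5.1 Thm. 5.1 (Theorem 5 of the author's version; k = 2)] -/
def sparseKSATInRAMTime_of_kOV_inTimeO : Prop :=
  ∀ (k : ℕ), 2 ≤ k → ∀ ε : ℝ, 0 < ε → ε ≤ 1 →
    (∀ c : ℕ, 1 ≤ c → (kOVWithDim k c).InTimeO fun n => (n : ℝ) ^ ((k : ℝ) - ε)) →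
    ∀ (k' c' : ℕ) (δ : ℝ), 1 - ε / k < δ → SparseKSATInRAMTime k' c' δ

/-! ### Assembly -/

/-- Shrinking the saving for a general exponent: an `O(n^{a-ε})` algorithm is an `O(n^{a-ε'})`
algorithm for `ε' ≤ ε` (for `n ≥ 1` the bound grows; `n = 0` is absorbed by the affine constant).
[folklore] -/
theorem inTimeO_rpow_sub_anti {P : FGProblem} {a ε ε' : ℝ} (hε' : ε' ≤ ε)
    (h : P.InTimeO fun n => (n : ℝ) ^ (a - ε)) : P.InTimeO fun n => (n : ℝ) ^ (a - ε') := by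
  refine inTimeO_of_le_add h zero_le_one (fun n => Real.rpow_nonneg (Nat.cast_nonneg n) _)
    (fun n => Real.rpow_nonneg (Nat.cast_nonneg n) _) fun n => ?_
  rcases Nat.eq_zero_or_pos n with rfl | hn
  · have h0 : ((0 : ℕ) : ℝ) ^ (a - ε) ≤ 1 := by
      rw [Nat.cast_zero]; exact Real.zero_rpow_le_one _
    have h0' : 0 ≤ ((0 : ℕ) : ℝ) ^ (a - ε') := Real.rpow_nonneg (Nat.cast_nonneg 0) _
    linarith
  · have h1 : (1 : ℝ) ≤ (n : ℝ) := by exact_mod_cast hn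
    have := Real.rpow_le_rpow_of_exponent_le h1 (show a - ε ≤ a - ε' by linarith)
    linarith

/-- **Assembly of fine-grained.S09, `k`-list form, in the word-RAM model (proved).** Sparsification
as a SERF reduction on the word RAM (`kSATInRAMTime_of_sparseKSATInRAMTime_serf`) and the `k`-way
split-and-list reduction (`sparseKSATInRAMTime_of_kOV_inTimeO`) imply the printed theorem
`not_kOVWithDim_inTimeO_of_sethWordRAM` (VVW ICM 2018, §3, Thm. 3.1 with the sparsification remark:
word-RAM SETH implies that `k`-OV in dimension `c log n` requires `n^{k-o(1)}` time) verbatim: if for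
some `k ≥ 2` and `ε > 0` `k`-OV had an `O(n^{k-ε})` algorithm in every dimension `c log n`, shrink
`ε` to `ε₁ = min ε 1`; sparse `k'`-SAT of every density is then in time `O(2^{(1 - 3ε₁/(4k)) n})`,
so `k'`-SAT is in time `O(2^{(1 - ε₁/(2k)) n})` for *every* `k'`, contradicting `SETHWordRAM` at
`ε₁/(2k)`. [cite: VassilevskaWilliamsICM2018, §3 Thm. 3.1] -/
theorem not_kOVWithDim_inTimeO_of_sethWordRAM_of
    (hsparse : kSATInRAMTime_of_sparseKSATInRAMTime_serf)
    (hsplit : sparseKSATInRAMTime_of_kOV_inTimeO) : not_kOVWithDim_inTimeO_of_sethWordRAM := by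
  intro hSETH k hk ε hε
  by_contra hno
  push Not at hno
  -- `hno : ∀ c, 1 ≤ c → (kOVWithDim k c).InTimeO fun n => n ^ (k - ε)`; shrink `ε` below `1`.
  set ε₁ : ℝ := min ε 1 with hε₁
  have hε₁pos : 0 < ε₁ := lt_min hε one_pos
  have hε₁le : ε₁ ≤ 1 := min_le_right _ _
  have hk0 : (0 : ℝ) < k := by exact_mod_cast (show 0 < k by omega)
  have hov : ∀ c : ℕ, 1 ≤ c → (kOVWithDim k c).InTimeO fun n => (n : ℝ) ^ ((k : ℝ) - ε₁) :=
    fun c hc => inTimeO_rpow_sub_anti (min_le_left _ _) (hno c hc)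
  have hq : 0 < ε₁ / (2 * k) := by positivity
  obtain ⟨k', -, hk'⟩ := hSETH (ε₁ / (2 * k)) hq
  refine hk' ?_
  obtain ⟨C, hC⟩ := hsparse k' (ε₁ / (4 * k)) (by positivity)
  have hδ : 1 - ε₁ / k < 1 - ε₁ / k + ε₁ / (4 * k) := by
    have : 0 < ε₁ / (4 * k) := by positivity
    linarith
  have hs : SparseKSATInRAMTime k' C (1 - ε₁ / k + ε₁ / (4 * k)) :=
    hsplit k hk ε₁ hε₁pos hε₁le hov k' C _ hδ
  have hnonneg : 0 ≤ 1 - ε₁ / k + ε₁ / (4 * k) := by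
    have h1 : ε₁ / k ≤ 1 := by
      rw [div_le_one hk0]
      have : (2 : ℝ) ≤ k := by exact_mod_cast hk
      linarith
    have h2 : 0 ≤ ε₁ / (4 * k) := by positivity
    linarith
  have hK := hC (1 - ε₁ / k + ε₁ / (4 * k)) hnonneg hs
  have hexp : 1 - ε₁ / k + ε₁ / (4 * k) + ε₁ / (4 * k) = 1 - ε₁ / (2 * k) := by
    field_simp
    ring
  rw [hexp] at hK
  exact hK

/-- Conversely to the decomposition, the target fact says nothing more than print once the two
ingredients are in: recorded as the contrapositive actually used — a fast `k`-OV algorithm in every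
dimension `c log n` makes *every* `k'`-SAT too fast for word-RAM SETH. [folklore] -/
theorem not_sethWordRAM_of_kOV_inTimeO (hsparse : kSATInRAMTime_of_sparseKSATInRAMTime_serf)
    (hsplit : sparseKSATInRAMTime_of_kOV_inTimeO) {k : ℕ} (hk : 2 ≤ k) {ε : ℝ} (hε : 0 < ε)
    (h : ∀ c : ℕ, 1 ≤ c → (kOVWithDim k c).InTimeO fun n => (n : ℝ) ^ ((k : ℝ) - ε)) :
    ¬ SETHWordRAM := fun hS => by
  obtain ⟨c, hc, hnot⟩ := not_kOVWithDim_inTimeO_of_sethWordRAM_of hsparse hsplit hS k hk ε hε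
  exact hnot (h c hc)

end Literature.Computability.FineGrained
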